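import Literature.Geometry.Riemannian.CompactSolitonScalarCurvature
import Literature.Analysis.PDE.HopfMinimumPrinciple
import HarnessLib

/-!
# Positivity of the scalar curvature of a compact shrinking gradient Ricci soliton

Sequel to `CompactSolitonScalarCurvature.lean` (`S ≥ 0` on a compact shrinking gradient Ricci
soliton, by the weak minimum principle) and `GradientSolitonIdentities.lean` (Hamilton's identity
`ΔS = ⟨∇f, ∇S⟩ + 2λS − 2|Ric|²`, in particular its coordinate form
`MetricCoord.IsMetricOn.lapAt_scalAt_of_soliton`). With **E. Hopf's strong minimum principle**
(`Literature.Analysis.PDE.hopf_minimumPrinciple_eventually_eq`, López-Gómez 2012, Thm. 1.2, proved in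
the tree) we PROVE:

* `MetricCoordEuclid.exists_pos_le_sum_ginv` — **uniform ellipticity of the inverse metric** on a
  compact set of a chart: `μ|ξ|² ≤ Σ g^{ij}(y) ξᵢ ξⱼ`;
* `scalarCurvature_eventuallyEq_zero_of_soliton` — on a gradient Ricci soliton
  `Ric + Hess f = λg`, `λ ≥ 0`, with `S ≥ 0`, the zero set of `S` is open: in the chart at a zero
  `x₀` of `S` the function `S ∘ φ⁻¹` is a non-negative `C²` solution of
  `−g^{ij}∂ᵢⱼS + bⁱ∂ᵢS + 2λ S = 2|Ric|² ≥ 0` (the identity above, written for the operator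
  `𝔏 = −Δ + ⟨∇f + g^{kl}Γ_{kl}, ∂⟩ + 2λ` of López-Gómez's form with `c = 2λ ≥ 0`), so Hopf's minimum
  principle makes it vanish near `φ(x₀)`;
* **`scalarCurvature_pos_of_compactSpace_soliton`** — on a compact connected manifold, a
  shrinking gradient Ricci soliton (`λ > 0`) has `S > 0` everywhere (Eminenti–La Nave–Mantegazza
  2008, §3: "`R` must be positive everywhere"; Ivey 1993): the zero set of `S` is open and
  closed, and it is not everything because at a maximum point of `f` the trace
  `S + Δf = nλ` of the soliton equation and `Δf ≤ 0` give `S ≥ nλ > 0`;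
* `ThreeShrinker.scalarCurvature_pos_of_compactSpace` — the same for the compact members of the
  binder of `threeShrinkerClassification_modelData` (`λ = ½`, `n = 3`).

Everything is proved; no new definitions of `Prop` type and no axioms are introduced.

## References

* M. Eminenti, G. La Nave, C. Mantegazza, *Ricci solitons: the equation point of view*,
  manuscripta math. 127 (2008) 345–367, §3 (the compact case). [EminentiLanaveMantegazza2008]
* T. Ivey, *Ricci solitons on compact three-manifolds*, Diff. Geom. Appl. 3 (1993) 301–307. [Ivey1993]
* J. López-Gómez, *Linear Second Order Elliptic Operators*, World Scientific 2013, Ch. 1,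
  Thm. 1.2. [LopezGomez2012]
* O. Munteanu, J. Wang, *Structure at infinity for shrinking Ricci solitons*, arXiv:1606.01861,
  §2 (p. 6). [MunteanuWang2016]
-/

noncomputable section

open Bundle Set Function Filter Module Metric
open scoped Manifold ContDiff Topology

namespace Literature.Geometry.Riemannian

open Lorentzian Lorentzian.PseudoRiemannianMetric

/-! ### Uniform ellipticity of the inverse metric in Euclidean coordinates -/

namespace MetricCoordEuclid

variable {n : ℕ}

/-- The covector with components `ξ` in the standard basis: `θ_ξ(w) = Σ ξⱼ wⱼ`. Its value on the
`j`-th basis vector is `ξⱼ`. [folklore] -/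
theorem sum_smul_coordCLM_apply_basisFun (ξ : EuclideanSpace ℝ (Fin n)) (j : Fin n) :
    (∑ k, ξ k • MetricCoord.coordCLM (EuclideanSpace.basisFun (Fin n) ℝ).toBasis k)
        ((EuclideanSpace.basisFun (Fin n) ℝ).toBasis j) = ξ j := by
  classical
  simp only [FunLike.coe_sum, Finset.sum_apply, FunLike.coe_smul,
    Pi.smul_apply, MetricCoord.coordCLM_apply, Basis.coord_apply, Basis.repr_self,
    smul_eq_mul]
  simp [Finsupp.single_apply]

/-- `θ_ξ(w) = Σⱼ ξⱼ wⱼ`. [folklore] -/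
theorem sum_smul_coordCLM_apply (ξ w : EuclideanSpace ℝ (Fin n)) :
    (∑ k, ξ k • MetricCoord.coordCLM (EuclideanSpace.basisFun (Fin n) ℝ).toBasis k) w =
      ∑ k, ξ k * w k := by
  simp only [FunLike.coe_sum, Finset.sum_apply, FunLike.coe_smul,
    Pi.smul_apply, MetricCoord.coordCLM_apply, Basis.coord_apply,
    OrthonormalBasis.coe_toBasis_repr_apply, EuclideanSpace.basisFun_repr, smul_eq_mul]

/-- **`Σ g^{ij} ξᵢ ξⱼ = θ_ξ(♯θ_ξ)`**: the inverse-metric quadratic form on components is the pairing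
of the covector `θ_ξ` with its metric dual. [cite: ONeill1983, Ch. 3, p. 60] -/
theorem sum_ginv_mul_mul_eq {G : EuclideanSpace ℝ (Fin n) →
      EuclideanSpace ℝ (Fin n) →L[ℝ] EuclideanSpace ℝ (Fin n) →L[ℝ] ℝ}
    (y ξ : EuclideanSpace ℝ (Fin n)) :
    ∑ i, ∑ j, MetricCoord.ginv G (EuclideanSpace.basisFun (Fin n) ℝ).toBasis y i j * ξ i * ξ j =
      (∑ k, ξ k • MetricCoord.coordCLM (EuclideanSpace.basisFun (Fin n) ℝ).toBasis k)
        (MetricCoord.sharpAt G y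
          (∑ k, ξ k • MetricCoord.coordCLM (EuclideanSpace.basisFun (Fin n) ℝ).toBasis k)) := by
  set bE := (EuclideanSpace.basisFun (Fin n) ℝ).toBasis with hbE
  set θ := ∑ k, ξ k • MetricCoord.coordCLM bE k with hθ
  rw [sum_smul_coordCLM_apply]
  refine Finset.sum_congr rfl fun i _ ↦ ?_
  have hc : (MetricCoord.sharpAt G y θ) i = bE.coord i (MetricCoord.sharpAt G y θ) := by
    rw [Basis.coord_apply, hbE, OrthonormalBasis.coe_toBasis_repr_apply, EuclideanSpace.basisFun_repr]
  rw [hc, MetricCoord.coord_sharpAt_eq_sum bE, Finset.mul_sum]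
  refine Finset.sum_congr rfl fun j _ ↦ ?_
  rw [hθ, sum_smul_coordCLM_apply_basisFun]
  ring

/-- **Uniform ellipticity of the inverse metric over a compact set.** For metric components `G`
positive definite on `T ⊇ K`, `K` compact, there is `μ > 0` with `μ|ξ|² ≤ Σ g^{ij}(y) ξᵢ ξⱼ` for all
`y ∈ K` and all `ξ` (the inverse-metric form is positive definite and continuous; minimum over
`K ×` the unit sphere). [cite: LopezGomez2012, (1.2)] -/
theorem exists_pos_le_sum_ginv {G : EuclideanSpace ℝ (Fin n) →
      EuclideanSpace ℝ (Fin n) →L[ℝ] EuclideanSpace ℝ (Fin n) →L[ℝ] ℝ}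
    {T K : Set (EuclideanSpace ℝ (Fin n))} (hGm : MetricCoord.IsMetricOn G T)
    (hpos : ∀ y ∈ T, ∀ v : EuclideanSpace ℝ (Fin n), v ≠ 0 → 0 < G y v v)
    (hK : IsCompact K) (hKT : K ⊆ T) :
    ∃ μ > 0, ∀ y ∈ K, ∀ ξ : EuclideanSpace ℝ (Fin n),
      μ * ‖ξ‖ ^ 2 ≤
        ∑ i, ∑ j, MetricCoord.ginv G (EuclideanSpace.basisFun (Fin n) ℝ).toBasis y i j * ξ i * ξ j := by
  set bE := (EuclideanSpace.basisFun (Fin n) ℝ).toBasis with hbE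
  -- the inverse-metric quadratic form
  set q : EuclideanSpace ℝ (Fin n) × EuclideanSpace ℝ (Fin n) → ℝ :=
    fun p ↦ ∑ i, ∑ j, MetricCoord.ginv G bE p.1 i j * p.2 i * p.2 j with hq
  set S : Set (EuclideanSpace ℝ (Fin n) × EuclideanSpace ℝ (Fin n)) := K ×ˢ sphere 0 1 with hS
  have hSc : IsCompact S := hK.prod (isCompact_sphere _ _)
  have hqc : ContinuousOn q S := by
    refine continuousOn_finsetSum _ fun i _ ↦ continuousOn_finsetSum _ fun j _ ↦ ?_
    have h1 : ContinuousOn (fun p : EuclideanSpace ℝ (Fin n) × EuclideanSpace ℝ (Fin n) ↦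
        MetricCoord.ginv G bE p.1 i j) S :=
      ((hGm.contDiffOn_ginv bE i j).continuousOn.mono hKT).comp continuous_fst.continuousOn
        fun p hp ↦ hp.1
    have h2 : ∀ k, Continuous fun p : EuclideanSpace ℝ (Fin n) × EuclideanSpace ℝ (Fin n) ↦
        p.2 k := fun k ↦ (EuclideanSpace.proj k).continuous.comp continuous_snd
    exact (h1.mul (h2 i).continuousOn).mul (h2 j).continuousOn
  -- positivity: `Σ g^{ij} ξᵢ ξⱼ = G(♯θ, ♯θ) > 0` for `ξ ≠ 0`
  have hqpos : ∀ y ∈ K, ∀ ξ : EuclideanSpace ℝ (Fin n), ξ ≠ 0 → 0 < q (y, ξ) := by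
    intro y hy ξ hξ
    have hi := hGm.isInvertible y (hKT hy)
    set θ := ∑ k, ξ k • MetricCoord.coordCLM bE k with hθ
    simp only [hq]
    rw [hbE, sum_ginv_mul_mul_eq, ← hbE, ← hθ, ← MetricCoord.apply_sharpAt_apply hi θ]
    refine hpos y (hKT hy) _ fun h0 ↦ hξ ?_
    ext j
    have h1 : θ (bE j) = ξ j := by rw [hθ, hbE, sum_smul_coordCLM_apply_basisFun]
    rw [← h1, ← MetricCoord.apply_sharpAt_apply hi θ (bE j), h0, map_zero, zero_apply,
      PiLp.zero_apply]
  -- scaling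
  have hscale : ∀ (y : EuclideanSpace ℝ (Fin n)) (r : ℝ) (ξ : EuclideanSpace ℝ (Fin n)),
      q (y, r • ξ) = r ^ 2 * q (y, ξ) := by
    intro y r ξ
    simp only [hq, PiLp.smul_apply, smul_eq_mul, Finset.mul_sum]
    refine Finset.sum_congr rfl fun i _ ↦ Finset.sum_congr rfl fun j _ ↦ ?_
    ring
  have key : ∀ μ : ℝ, (∀ p ∈ S, μ ≤ q p) → ∀ y ∈ K, ∀ ξ : EuclideanSpace ℝ (Fin n),
      μ * ‖ξ‖ ^ 2 ≤ q (y, ξ) := by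
    intro μ hμ y hy ξ
    by_cases hξ : ξ = 0
    · subst hξ
      have : q (y, 0) = 0 := by simp [hq]
      simp [this]
    · have hnorm : 0 < ‖ξ‖ := norm_pos_iff.2 hξ
      have hmem : (y, ‖ξ‖⁻¹ • ξ) ∈ S := by
        refine ⟨hy, ?_⟩
        rw [mem_sphere_zero_iff_norm, norm_smul, norm_inv, norm_norm, inv_mul_cancel₀ hnorm.ne']
      have h1 := hμ _ hmem
      have h2 : q (y, ξ) = ‖ξ‖ ^ 2 * q (y, ‖ξ‖⁻¹ • ξ) := by
        rw [hscale, ← mul_assoc, ← mul_pow, mul_inv_cancel₀ hnorm.ne', one_pow, one_mul]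
      rw [h2]
      nlinarith [sq_nonneg ‖ξ‖, mul_le_mul_of_nonneg_left h1 (sq_nonneg ‖ξ‖)]
  rcases S.eq_empty_or_nonempty with hSe | hSne
  · exact ⟨1, one_pos, key 1 fun p hp ↦ by rw [hSe] at hp; exact hp.elim⟩
  · obtain ⟨p₀, hp₀, hmin⟩ := hSc.exists_isMinOn hSne hqc
    have hp₀pos : 0 < q p₀ := by
      have hne : p₀.2 ≠ 0 := by
        have : ‖p₀.2‖ = 1 := mem_sphere_zero_iff_norm.1 hp₀.2
        rintro h
        rw [h, norm_zero] at this
        exact zero_ne_one this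
      exact hqpos p₀.1 hp₀.1 p₀.2 hne
    exact ⟨q p₀, hp₀pos, key _ fun p hp ↦ hmin hp⟩

end MetricCoordEuclid

/-! ### The zero set of `S` is open -/

section Local

variable {n : ℕ} {M : Type*} [TopologicalSpace M] [ChartedSpace (EuclideanSpace ℝ (Fin n)) M]
  [IsManifold (𝓡 n) ∞ M]
  (g : PseudoRiemannianMetric (𝓡 n) ∞ (EuclideanSpace ℝ (Fin n)) (TangentSpace (𝓡 n) : M → Type _))
  [g.HasLeviCivita]

/-- **The zero set of the scalar curvature of a gradient Ricci soliton with `S ≥ 0`, `λ ≥ 0`, is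
open** (E. Hopf's strong minimum principle applied, in the chart at a zero `x₀` of `S`, to the
non-negative solution `S ∘ φ⁻¹` of `−g^{ij}∂ᵢⱼS + ⟨g^{kl}Γ_{kl} + ∇f, ∂S⟩ + 2λS = 2|Ric|² ≥ 0`,
Hamilton's identity `ΔS − ⟨∇f, ∇S⟩ = 2λS − 2|Ric|²`).
[cite: EminentiLanaveMantegazza2008, §3] [cite: LopezGomez2012, Thm. 1.2]
[cite: MunteanuWang2016, §2 (p. 6)] -/
theorem scalarCurvature_eventuallyEq_zero_of_soliton (hg : g.IsRiemannian) {f : M → ℝ}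
    (hf : ContMDiff (𝓡 n) 𝓘(ℝ, ℝ) ∞ f) {lam : ℝ} (hlam : 0 ≤ lam)
    (hsol : ∀ (x : M) (X Y : TangentSpace (𝓡 n) x),
      g.ricci x X Y + g.hessian f x X Y = lam * g.val x X Y)
    (hS0 : ∀ x, 0 ≤ g.scalarCurvature x) {x₀ : M} (hx₀ : g.scalarCurvature x₀ = 0) :
    ∀ᶠ x in 𝓝 x₀, g.scalarCurvature x = 0 := by
  classical
  set bE := (EuclideanSpace.basisFun (Fin n) ℝ).toBasis with hbE
  -- the chart at `x₀`, components and representatives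
  set G := chartRep (𝓡 n) (fun _ ↦ g) x₀ 0 with hGdef
  set T : Set (EuclideanSpace ℝ (Fin n)) := (extChartAt (𝓡 n) x₀).target with hT
  have hTo : IsOpen T := isOpen_extChartAt_target x₀
  have hGm : MetricCoord.IsMetricOn G T :=
    Lorentzian.OpensChart.isMetricOn_repr (val_chartPullback_eq_chartRep (fun _ : ℝ ↦ g) x₀ 0)
  have hGpos : ∀ y ∈ T, ∀ v : EuclideanSpace ℝ (Fin n), v ≠ 0 → 0 < G y v v := by
    intro y hy v hv
    rw [hGdef, show y = ((⟨y, hy⟩ : chartTarget (𝓡 n) x₀) : EuclideanSpace ℝ (Fin n)) from rfl,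
      chartRep_apply]
    exact chartPullback_pos g x₀ ⟨y, hy⟩ (fun w hw ↦ hg _ w hw) v hv
  set fc : EuclideanSpace ℝ (Fin n) → ℝ := f ∘ (extChartAt (𝓡 n) x₀).symm with hfc
  set Sc : EuclideanSpace ℝ (Fin n) → ℝ := g.scalarCurvature ∘ (extChartAt (𝓡 n) x₀).symm with hSc
  have hfcs : ContDiffOn ℝ ∞ fc T := by
    rw [hfc, ← contMDiffOn_iff_contDiffOn]
    exact hf.comp_contMDiffOn (contMDiffOn_extChartAt_symm x₀)
  have hScs : ContDiffOn ℝ ∞ Sc T := by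
    rw [hSc, ← contMDiffOn_iff_contDiffOn]
    exact (contMDiff_scalarCurvature g).comp_contMDiffOn (contMDiffOn_extChartAt_symm x₀)
  have hsolc := soliton_chartRep_target g x₀ hf hsol
  have hScal : ∀ y ∈ T, Sc y = MetricCoord.scalAt G y := fun y hy ↦
    Lorentzian.scalarCurvature_chartInv_eq g x₀ ⟨y, hy⟩
  have hSgerm : ∀ y ∈ T, Sc =ᶠ[𝓝 y] MetricCoord.scalAt G := fun y hy ↦ by
    filter_upwards [hTo.mem_nhds hy] with z hz using hScal z hz
  -- `|Ric|² ≥ 0` in the chart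
  have hN : ∀ y ∈ T, 0 ≤ MetricCoord.normSqAt G y (MetricCoord.ricAt G y) := by
    intro y hy
    haveI := (chartPullback (𝓡 n) g x₀).hasLeviCivita
    have hpb : (chartPullback (𝓡 n) g x₀).IsRiemannian := fun u w hw ↦
      chartPullback_pos g x₀ u (fun w' hw' ↦ hg _ w' hw') w hw
    rw [hGdef, ← Lorentzian.OpensChart.normSq_ricci_eq_normSqAt
      (val_chartPullback_eq_chartRep (fun _ : ℝ ↦ g) x₀ 0) ⟨y, hy⟩]
    exact (chartPullback (𝓡 n) g x₀).normSq_nonneg _ hpb _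
  -- a closed ball in the chart around `u₀ = φ x₀`
  set u₀ : EuclideanSpace ℝ (Fin n) := extChartAt (𝓡 n) x₀ x₀ with hu₀
  have hu₀T : u₀ ∈ T := mem_extChartAt_target x₀
  obtain ⟨R, hR, hRT⟩ := nhds_basis_closedBall.mem_iff.mp (hTo.mem_nhds hu₀T)
  set Ω : Set (EuclideanSpace ℝ (Fin n)) := ball u₀ R with hΩ
  have hΩT : Ω ⊆ T := ball_subset_closedBall.trans hRT
  -- the coefficients of `𝔏 = −g^{ij}∂ᵢⱼ + bⁱ∂ᵢ + 2λ`
  set a : EuclideanSpace ℝ (Fin n) → Fin n → Fin n → ℝ := fun y i j ↦ MetricCoord.ginv G bE y i j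
    with ha
  set wv : EuclideanSpace ℝ (Fin n) → EuclideanSpace ℝ (Fin n) := fun y ↦
    (∑ k, ∑ l, MetricCoord.ginv G bE y k l • MetricCoord.chrAt G y (bE k) (bE l)) +
      MetricCoord.sharpAt G y (fderiv ℝ fc y) with hwv
  set bco : EuclideanSpace ℝ (Fin n) → Fin n → ℝ := fun y i ↦ wv y i with hbco
  -- (i) symmetry and ellipticity
  have ha_symm : ∀ y ∈ Ω, ∀ i j, a y i j = a y j i := fun y hy i j ↦
    MetricCoord.ginv_comm bE (hGm.isInvertible y (hΩT hy)) (hGm.symm y (hΩT hy)) i j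
  obtain ⟨μ, hμ, hell'⟩ :=
    MetricCoordEuclid.exists_pos_le_sum_ginv hGm hGpos (isCompact_closedBall u₀ R) hRT
  have hell : ∀ y ∈ Ω, ∀ ξ : EuclideanSpace ℝ (Fin n),
      μ * ‖ξ‖ ^ 2 ≤ ∑ i, ∑ j, a y i j * ξ i * ξ j := fun y hy ξ ↦
    hell' y (ball_subset_closedBall hy) ξ
  -- (ii) local boundedness of the coefficients
  have hwvc : ContinuousOn wv T := by
    refine ContinuousOn.add (continuousOn_finsetSum _ fun k _ ↦
      continuousOn_finsetSum _ fun l _ ↦ ?_) ?_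
    · exact (hGm.contDiffOn_ginv bE k l).continuousOn.smul
        ((hGm.contDiffOn_chrAt.continuousOn.clm_apply continuousOn_const).clm_apply
          continuousOn_const)
    · exact hGm.contDiffOn_sharpAt.continuousOn.clm_apply
        (hfcs.continuousOn_fderiv_of_isOpen hTo (by simp))
  have hbdd : ∀ K ⊆ Ω, IsCompact K →
      ∃ C, ∀ y ∈ K, (∀ i j, |a y i j| ≤ C) ∧ (∀ i, |bco y i| ≤ C) ∧ |(fun _ ↦ 2 * lam) y| ≤ C := by
    intro K hKΩ hK
    have hKT : K ⊆ T := hKΩ.trans hΩT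
    set Φ : EuclideanSpace ℝ (Fin n) → ℝ := fun y ↦
      (∑ i, ∑ j, |a y i j|) + (∑ i, |bco y i|) + |2 * lam| with hΦ
    have hΦc : ContinuousOn Φ K := by
      refine ContinuousOn.add (ContinuousOn.add (continuousOn_finsetSum _ fun i _ ↦
        continuousOn_finsetSum _ fun j _ ↦ ?_) (continuousOn_finsetSum _ fun i _ ↦ ?_))
        continuousOn_const
      · exact ((hGm.contDiffOn_ginv bE i j).continuousOn.mono hKT).abs
      · exact (((EuclideanSpace.proj i).continuous.comp_continuousOn (hwvc.mono hKT))).abs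
    obtain ⟨C, hC⟩ := hK.exists_bound_of_continuousOn hΦc
    have hΦle : ∀ y ∈ K, Φ y ≤ C := fun y hy ↦ (Real.le_norm_self _).trans (hC y hy)
    have h1 : ∀ y i j, |a y i j| ≤ Φ y := fun y i j ↦ by
      have h := Finset.single_le_sum (f := fun j ↦ |a y i j|) (fun _ _ ↦ abs_nonneg _)
        (Finset.mem_univ j)
      have h' := Finset.single_le_sum (f := fun i ↦ ∑ j, |a y i j|)
        (fun _ _ ↦ Finset.sum_nonneg fun _ _ ↦ abs_nonneg _) (Finset.mem_univ i)
      have h3 : 0 ≤ ∑ i, |bco y i| := Finset.sum_nonneg fun _ _ ↦ abs_nonneg _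
      have h4 : 0 ≤ |2 * lam| := abs_nonneg _
      simp only [hΦ]
      linarith
    have h2 : ∀ y i, |bco y i| ≤ Φ y := fun y i ↦ by
      have h := Finset.single_le_sum (f := fun i ↦ |bco y i|) (fun _ _ ↦ abs_nonneg _)
        (Finset.mem_univ i)
      have h3 : 0 ≤ ∑ i, ∑ j, |a y i j| :=
        Finset.sum_nonneg fun _ _ ↦ Finset.sum_nonneg fun _ _ ↦ abs_nonneg _
      have h4 : 0 ≤ |2 * lam| := abs_nonneg _
      simp only [hΦ]
      linarith
    have h3 : ∀ y : EuclideanSpace ℝ (Fin n), |(fun _ ↦ 2 * lam) y| ≤ Φ y := fun y ↦ by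
      have h3 : 0 ≤ ∑ i, ∑ j, |a y i j| :=
        Finset.sum_nonneg fun _ _ ↦ Finset.sum_nonneg fun _ _ ↦ abs_nonneg _
      have h4 : 0 ≤ ∑ i, |bco y i| := Finset.sum_nonneg fun _ _ ↦ abs_nonneg _
      simp only [hΦ]
      linarith
    exact ⟨C, fun y hy ↦ ⟨fun i j ↦ (h1 y i j).trans (hΦle y hy),
      fun i ↦ (h2 y i).trans (hΦle y hy), (h3 y).trans (hΦle y hy)⟩⟩
  -- (iii) the differential inequality `𝔏 Sc = 2|Ric|² ≥ 0` on `Ω`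
  have hLu : ∀ y ∈ Ω, 0 ≤ -(∑ i, ∑ j, a y i j * fderiv ℝ (fderiv ℝ Sc) y
      (EuclideanSpace.single i 1) (EuclideanSpace.single j 1)) +
      ∑ i, bco y i * fderiv ℝ Sc y (EuclideanSpace.single i 1) + (fun _ ↦ 2 * lam) y * Sc y := by
    intro y hyΩ
    have hy : y ∈ T := hΩT hyΩ
    -- first-order part: `Σ bᵢ ∂ᵢSc = DSc(wv)`
    have hfirst : ∑ i, bco y i * fderiv ℝ Sc y (EuclideanSpace.single i 1) =
        fderiv ℝ Sc y (wv y) := by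
      conv_rhs => rw [← (EuclideanSpace.basisFun (Fin n) ℝ).sum_repr (wv y)]
      simp only [map_sum, map_smul, smul_eq_mul, EuclideanSpace.basisFun_repr,
        EuclideanSpace.basisFun_apply, hbco]
    -- second-order part: `Σ aᵢⱼ ∂ᵢⱼSc − DSc(Σ g^{kl}Γ_{kl}) = lapAt G Sc`
    have hbEi : ∀ i, (bE i : EuclideanSpace ℝ (Fin n)) = EuclideanSpace.single i 1 := fun i ↦ by
      rw [hbE, OrthonormalBasis.coe_toBasis, EuclideanSpace.basisFun_apply]
    have hsecond : ∑ i, ∑ j, a y i j * fderiv ℝ (fderiv ℝ Sc) y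
        (EuclideanSpace.single i 1) (EuclideanSpace.single j 1) -
        fderiv ℝ Sc y (∑ k, ∑ l, MetricCoord.ginv G bE y k l • MetricCoord.chrAt G y (bE k) (bE l)) =
        MetricCoord.lapAt G Sc y := by
      rw [MetricCoord.lapAt_eq_sum G bE Sc y]
      simp only [map_sum, map_smul, smul_eq_mul, ha, hbEi, mul_sub, Finset.sum_sub_distrib]
    -- the chart identity `Δ scalAt = D scalAt(♯Df̂) + 2λ scalAt − 2|Ric|²`
    have hlap := hGm.lapAt_scalAt_of_soliton hy hfcs hsolc
    have hgerm := hSgerm y hy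
    have hL1 : MetricCoord.lapAt G Sc y = MetricCoord.lapAt G (MetricCoord.scalAt G) y :=
      MetricCoord.lapAt_congr_of_eventuallyEq G hgerm
    have hD1 : fderiv ℝ Sc y = fderiv ℝ (MetricCoord.scalAt G) y := hgerm.fderiv_eq
    have hwvy : fderiv ℝ Sc y (wv y) =
        fderiv ℝ Sc y (∑ k, ∑ l, MetricCoord.ginv G bE y k l • MetricCoord.chrAt G y (bE k) (bE l)) +
          fderiv ℝ Sc y (MetricCoord.sharpAt G y (fderiv ℝ fc y)) := by
      rw [hwv, map_add]
    have hkey : -(∑ i, ∑ j, a y i j * fderiv ℝ (fderiv ℝ Sc) y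
        (EuclideanSpace.single i 1) (EuclideanSpace.single j 1)) +
        ∑ i, bco y i * fderiv ℝ Sc y (EuclideanSpace.single i 1) + (fun _ ↦ 2 * lam) y * Sc y =
        2 * MetricCoord.normSqAt G y (MetricCoord.ricAt G y) := by
      rw [hfirst, hwvy]
      have h2 := hsecond
      rw [hL1, hlap] at h2
      rw [hD1, hScal y hy]
      rw [hD1] at h2
      simp only
      linarith
    rw [hkey]
    exact mul_nonneg two_pos.le (hN y hy)
  -- (iv) Hopf's minimum principle
  have hu : ContDiffOn ℝ 2 Sc Ω := (hScs.of_le (WithTop.coe_le_coe.mpr le_top)).mono hΩT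
  have hum : ∀ y ∈ Ω, (0 : ℝ) ≤ Sc y := fun y _ ↦ hS0 _
  have hcn : ∀ y ∈ Ω, 0 ≤ (fun _ : EuclideanSpace ℝ (Fin n) ↦ 2 * lam) y := fun _ _ ↦ by
    simp only
    positivity
  have hSu₀ : Sc u₀ = 0 := by
    simp only [hSc, hu₀, Function.comp_apply, extChartAt_to_inv]
    exact hx₀
  have hev : ∀ᶠ y in 𝓝 u₀, Sc y = 0 :=
    Literature.Analysis.PDE.hopf_minimumPrinciple_eventually_eq isOpen_ball ha_symm hμ hell hbdd
      hcn hu hLu le_rfl hum (mem_ball_self hR) hSu₀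
  -- (v) back to the manifold
  have h1 : ∀ᶠ x in 𝓝 x₀, Sc (extChartAt (𝓡 n) x₀ x) = 0 :=
    (continuousAt_extChartAt (I := 𝓡 n) x₀).eventually hev
  filter_upwards [h1, extChartAt_source_mem_nhds (I := 𝓡 n) x₀] with x hx hxs
  simpa only [hSc, Function.comp_apply, (extChartAt (𝓡 n) x₀).left_inv hxs] using hx

end Local

/-! ### `S > 0` on a compact shrinking soliton -/

section Compact

variable {n : ℕ} {M : Type*} [TopologicalSpace M] [ChartedSpace (EuclideanSpace ℝ (Fin n)) M]
  [IsManifold (𝓡 n) ∞ M]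
  (g : PseudoRiemannianMetric (𝓡 n) ∞ (EuclideanSpace ℝ (Fin n)) (TangentSpace (𝓡 n) : M → Type _))
  [g.HasLeviCivita]

/-- The trace of the soliton equation: `S + Δf = nλ`. [cite: EminentiLanaveMantegazza2008, §1] -/
theorem scalarCurvature_add_dalembertian_of_soliton {f : M → ℝ} {lam : ℝ}
    (hsol : ∀ (x : M) (X Y : TangentSpace (𝓡 n) x),
      g.ricci x X Y + g.hessian f x X Y = lam * g.val x X Y) (x : M) :
    g.scalarCurvature x + g.dalembertian f x = lam * n := by
  have hform : g.ricci x + g.hessian f x = lam • g.toBilinForm x := by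
    ext X Y
    simpa using hsol x X Y
  have htr : g.trace x (g.ricci x + g.hessian f x) = g.trace x (g.ricci x) + g.trace x (g.hessian f x) := by
    simp only [PseudoRiemannianMetric.trace, LinearMap.comp_add, map_add]
  rw [scalarCurvature, dalembertian, ← htr, hform, trace_smul, trace_toBilinForm_eq,
    finrank_euclideanSpace_fin]

/-- **The scalar curvature of a compact shrinking gradient Ricci soliton is positive**
(Eminenti–La Nave–Mantegazza 2008, §3; Ivey 1993). For a `C^∞` Riemannian metric `g` on a
compact connected manifold and a `C^∞` function `f` with `Ric + Hess f = λg`, `λ > 0`: `S > 0`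
everywhere. Proof: `S ≥ 0` (`scalarCurvature_nonneg_of_compactSpace_soliton`); the zero set of
`S` is open (`scalarCurvature_eventuallyEq_zero_of_soliton`, Hopf's strong minimum principle) and
closed, hence empty or everything; at a maximum point of `f`, `S = nλ − Δf ≥ nλ > 0`.
[cite: EminentiLanaveMantegazza2008, §3] [cite: Ivey1993] [cite: LopezGomez2012, Thm. 1.2] -/
theorem scalarCurvature_pos_of_compactSpace_soliton [CompactSpace M] [ConnectedSpace M]
    (hn : 0 < n) (hg : g.IsRiemannian) {f : M → ℝ} (hf : ContMDiff (𝓡 n) 𝓘(ℝ, ℝ) ∞ f) {lam : ℝ}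
    (hlam : 0 < lam)
    (hsol : ∀ (x : M) (X Y : TangentSpace (𝓡 n) x),
      g.ricci x X Y + g.hessian f x X Y = lam * g.val x X Y) (x : M) :
    0 < g.scalarCurvature x := by
  have hS0 : ∀ y, 0 ≤ g.scalarCurvature y :=
    scalarCurvature_nonneg_of_compactSpace_soliton g hg hf hlam hsol
  -- the zero set is clopen
  set Z : Set M := {y | g.scalarCurvature y = 0} with hZ
  have hZo : IsOpen Z := by
    rw [isOpen_iff_mem_nhds]
    intro y hy
    exact scalarCurvature_eventuallyEq_zero_of_soliton g hg hf hlam.le hsol hS0 hy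
  have hZc : IsClosed Z := isClosed_eq (contMDiff_scalarCurvature g).continuous continuous_const
  have hZcl : IsClopen Z := ⟨hZc, hZo⟩
  -- it is not everything: at a maximum point of `f`, `S ≥ nλ > 0`
  obtain ⟨xM, -, hxM⟩ := isCompact_univ.exists_isMaxOn univ_nonempty hf.continuous.continuousOn
  have hf2 : ContMDiff (𝓡 n) 𝓘(ℝ, ℝ) 2 f := hf.of_le (WithTop.coe_le_coe.mpr le_top)
  have hΔ : g.dalembertian f xM ≤ 0 :=
    g.dalembertian_nonpos_of_isLocalMax hf2.contMDiffAt (hxM.isLocalMax univ_mem) (hg xM)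
  have htr := scalarCurvature_add_dalembertian_of_soliton g hsol xM
  have hSM : 0 < g.scalarCurvature xM := by
    have : (0 : ℝ) < lam * n := mul_pos hlam (Nat.cast_pos.mpr hn)
    linarith
  have hZne : Z ≠ univ := fun h ↦ by
    have : xM ∈ Z := h ▸ mem_univ xM
    exact hSM.ne' this
  have hZe : Z = ∅ := (isClopen_iff.mp hZcl).resolve_right hZne
  exact lt_of_le_of_ne (hS0 x) fun h ↦ by
    have : x ∈ Z := h.symm
    rw [hZe] at this
    exact this

end Compact

/-! ### The binder of `threeShrinkerClassification_modelData` -/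

namespace ThreeShrinker

/-- **`R > 0` for the compact members of the binder of `threeShrinkerClassification_modelData`**
(`λ = ½`, `n = 3`). [cite: EminentiLanaveMantegazza2008, §3] [cite: Ivey1993]
[cite: MunteanuWang2016, §1 (p. 2)] -/
theorem scalarCurvature_pos_of_compactSpace (N : Type*) [TopologicalSpace N]
    [ChartedSpace (EuclideanSpace ℝ (Fin 3)) N] [IsManifold (𝓡 3) ∞ N] [ConnectedSpace N]
    [CompactSpace N]
    (h : PseudoRiemannianMetric (𝓡 3) ∞ (EuclideanSpace ℝ (Fin 3))
      (TangentSpace (𝓡 3) : N → Type _)) [h.HasLeviCivita]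
    (φ : N → ℝ) (hh : h.IsRiemannian) (hφ : ContMDiff (𝓡 3) 𝓘(ℝ, ℝ) ∞ φ)
    (hsol : ∀ (x : N) (X Y : TangentSpace (𝓡 3) x),
      h.ricci x X Y + h.hessian φ x X Y = (1 / 2 : ℝ) * h.val x X Y) (x : N) :
    0 < h.scalarCurvature x :=
  scalarCurvature_pos_of_compactSpace_soliton h (by norm_num) hh hφ (by norm_num) hsol x

end ThreeShrinker

end Literature.Geometry.Riemannian

end
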